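import Summits.QuantumFields.YangMills.Theorems.FlatTubeReductionBOProjectionAdapted
import Summits.QuantumFields.YangMills.Theorems.LuscherReductionTwistedTraceScalingBOAssemblySlow
import HarnessLib

/-!
# The SLOW-WITH-RATE clause of the rate-grade Born–Oppenheimer tube package from its bricks (adapted fibres, DRESSED one-site form) — rate twin of lane A's `…BOAssemblySlow`
# (route `FlatTubeReduction`, crux K1 `NearFlatRatioLaw` stmt-QuantumFields-24720; seat `ym-line-ftr-p1` g9; R2b1 RECORD rung — no summit statement is proved here)

At a fixed `β`, the SLOW clause of `RateTube.SoftTubeBORatePackageOn` (p648741) for the ADAPTED projection `P = boProjAd w Ω 𝒰` (p648949, fibre profile `Ω_u` depending on the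
slow variable, EQUIVARIANT under global colour rotations) follows, exactly as in lane A's `slow_clause_of_bricks` (p647299), from: (CA) the colour average (`tubeForm_colourAvg`,
`tubeNormSq_colourAvg_le`, ★ `colourAvg_boFunAd`); (B-N) `|fibreMassAd − γ| ≤ κγ` on `𝒰`; (B-T)-RATE, upper: the tube form of an adapted BO function with gauge-invariant amplitude
`φ ⊆ 𝒰` is `≤ σγ(1+κ)·⟨φW, K_B φW⟩₁ + κσγμ₀‖φ‖²` — against the DRESSED one-site form, `W` the frozen-fibre weight (`0 ≤ W ≤ 1`, `Ad`-invariant; `W² = λ(u)/λ(1)`, toolkit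
`borate-rate-toolkit-g7.md`) — the OWED Laplace brick, a HYPOTHESIS here; (OS)-RATE the one-site inner statement (`RateTube.oneOrbitRate_one`, p650289; its conclusion at `B` is a
hypothesis here, applied to the dressed family `GᵢW`); and lane A's arithmetic (`arith_slow` with `y := Cλ_b²`).  All exponents enter as real numbers (`e^{ε'λ}`, `e^{ελ/4}`), so the
RATE instance is `ε' := λ_b`, `ε := Cλ_b`.
* ★ `colourAvg_slowProductAd`, ★ `colourAvg_boFunAd`, ★ `tubeNormSq_boFunAd`, `boFunAd_ne_zero`, `fibreInnerAd_eq_zero_of_vanish` (lane A's Prelim, adapted profile);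
* ★★★ `slow_rate_clause_of_bricks` — `∃ a ≠ 0, tubeForm β (u_a) ≤ e^{ελ/4}·σ·μ_k·tubeNormSq w (u_a)`, `u_a = Σ aᵢ·boProjAd w Ω 𝒰 fᵢ`.
HONEST FRAMING: assembly algebra for the rate twin of a stub of a child of the CONDITIONAL reduction route R2b1; (B-T)-rate is OPEN; not a gap, not Clay.  No defs, no `sorry`.
-/

set_option autoImplicit false

noncomputable section

open MeasureTheory Filter Topology Real
open scoped BigOperators
open Literature.MathematicalPhysics.QuantumFieldTheory
open Literature.MathematicalPhysics.QuantumLattice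

namespace Summit.QuantumFields.YangMills.Theorems.FemtoTransferGap.RateTube

open Summit.QuantumFields.YangMills.Theorems.FemtoTransferGap
open Summit.QuantumFields.YangMills.Theorems.FemtoTransferGap.TwoLattice.Avg
open Summit.QuantumFields.YangMills.Theorems.FemtoTransferGap.TwoLattice.ConstTube
open Summit.QuantumFields.YangMills.Theorems.FemtoTransferGap.TwoLattice.Stiff (LinkSpace)

variable (L : ℕ) [NeZero L]

/-! ## §1 The colour average and the weighted norm of an adapted BO function; supports -/

/-- ★ **Colour average of an ADAPTED BO product**: for an EQUIVARIANT fibre profile (`Ω_{g·u}(R_g v) = Ω_u(v)`),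
`colourAvg (fun U => φ (slowMean U) * Ω (slowMean U) (relLinkVec U)) U = colourAvg φ (slowMean U) * Ω (slowMean U) (relLinkVec U)`. [folklore] -/
theorem colourAvg_slowProductAd (φ : GaugeConfig 3 1 SU2 → ℝ) {Ω : GaugeConfig 3 1 SU2 → LinkSpace L → ℝ}
    (hΩ : ∀ (g : SU2) (u : GaugeConfig 3 1 SU2) (v : LinkSpace L), Ω (gaugeTransform (fun _ : Site 3 1 => g) u) (adL L g v) = Ω u v)
    (U : GaugeConfig 3 L SU2) :
    colourAvg (fun V => φ (slowMean L V) * Ω (slowMean L V) (relLinkVec L V)) U = colourAvg (L := 1) φ (slowMean L U) * Ω (slowMean L U) (relLinkVec L U) := by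
  unfold colourAvg
  rw [← integral_mul_const]
  refine integral_congr_ae (ae_of_all _ fun g => ?_)
  dsimp only
  rw [slowMean_conj, relLinkVec_conj, hΩ]

/-- ★ **Colour average of a BO function**: `colourAvg (boFunAd φ Ω) = boFunAd (colourAvg φ) Ω` for colour-blind `Ω` (the right-hand `colourAvg` is the one-site one).
[folklore] -/
theorem colourAvg_boFunAd (φ : GaugeConfig 3 1 SU2 → ℝ) {Ω : GaugeConfig 3 1 SU2 → LinkSpace L → ℝ}
    (hΩ : ∀ (g : SU2) (u : GaugeConfig 3 1 SU2) (v : LinkSpace L), Ω (gaugeTransform (fun _ : Site 3 1 => g) u) (adL L g v) = Ω u v) (U : GaugeConfig 3 L SU2) :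
    colourAvg (boFunAd L φ Ω) U = boFunAd L (colourAvg (L := 1) φ) Ω U := by
  unfold boFunAd
  by_cases hU : U ∈ orthoTubeSet L
  · rw [Set.indicator_of_mem hU, one_mul, ← colourAvg_slowProductAd L φ hΩ U]
    unfold colourAvg
    refine integral_congr_ae (ae_of_all _ fun g => ?_)
    dsimp only
    rw [Set.indicator_of_mem ((conj_mem_orthoTubeSet_iff L g U).mpr hU), one_mul]
  · rw [Set.indicator_of_notMem hU, zero_mul]
    unfold colourAvg
    have h : ∀ g : SU2, (orthoTubeSet L).indicator (fun _ => (1 : ℝ)) (gaugeTransform (fun _ : Site 3 L => g) U) *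
        (φ (slowMean L (gaugeTransform (fun _ : Site 3 L => g) U)) * Ω (slowMean L (gaugeTransform (fun _ : Site 3 L => g) U)) (relLinkVec L (gaugeTransform (fun _ : Site 3 L => g) U))) = 0 := fun g => by
      rw [Set.indicator_of_notMem (fun h => hU ((conj_mem_orthoTubeSet_iff L g U).mp h)), zero_mul]
    simp [h]

/-! ## §2 The weighted norm of a BO function -/

variable {L}

/-- ★ **`‖boFunAd φ Ω‖²_w = ∫ φ(u)²·fibreMassAd w Ω u du`** (bounded measurable data). [folklore] -/
theorem tubeNormSq_boFunAd {φ : GaugeConfig 3 1 SU2 → ℝ} (hφ : Measurable φ) {Cφ : ℝ} (hCφ : ∀ u, |φ u| ≤ Cφ) {Ω : GaugeConfig 3 1 SU2 → LinkSpace L → ℝ} (hΩ : Measurable (Function.uncurry Ω)) {CΩ : ℝ}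
    (hCΩ : ∀ u x, |Ω u x| ≤ CΩ) {w : GaugeConfig 3 L SU2 → ℝ} (hw : Measurable w) {Cw : ℝ} (hCw : ∀ U, |w U| ≤ Cw) :
    tubeNormSq w (boFunAd L φ Ω) = ∫ u, φ u ^ 2 * fibreMassAd L w Ω u ∂configMeasure SU2 1 := by
  unfold tubeNormSq
  have e : (fun U => boFunAd L φ Ω U ^ 2 * w U) = fun U => boFunAd L φ Ω U * boFunAd L φ Ω U * w U := by funext U; ring
  rw [e, integral_boFunAd_mul_eq hφ hCφ hΩ hCΩ (measurable_boFunAd L hφ hΩ) (abs_boFunAd_le L hCφ hCΩ) hw hCw]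
  refine integral_congr_ae (ae_of_all _ fun u => ?_)
  dsimp only
  rw [fibreInnerAd_boFunAd]; ring

variable (L) in
/-- A BO function is supported on the tube, where its slow amplitude and fibre profile are nonzero. [folklore] -/
theorem boFunAd_ne_zero {φ : GaugeConfig 3 1 SU2 → ℝ} {Ω : GaugeConfig 3 1 SU2 → LinkSpace L → ℝ} {U : GaugeConfig 3 L SU2} (h : boFunAd L φ Ω U ≠ 0) :
    U ∈ orthoTubeSet L ∧ φ (slowMean L U) ≠ 0 ∧ Ω (slowMean L U) (relLinkVec L U) ≠ 0 := by
  unfold boFunAd at h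
  by_cases hU : U ∈ orthoTubeSet L
  · rw [Set.indicator_of_mem hU, one_mul] at h
    exact ⟨hU, left_ne_zero_of_mul h, right_ne_zero_of_mul h⟩
  · rw [Set.indicator_of_notMem hU, zero_mul] at h
    exact absurd rfl h

/-- Fibre pairings vanish over slow points on whose fibre the function vanishes (the transverse measure is carried by the cap). [folklore] -/
theorem fibreInnerAd_eq_zero_of_vanish {w : GaugeConfig 3 L SU2 → ℝ} {Ω : GaugeConfig 3 1 SU2 → LinkSpace L → ℝ} {g : GaugeConfig 3 L SU2 → ℝ} {u : GaugeConfig 3 1 SU2}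
    (hg : ∀ v ∈ capBalancedSet L, g (orthoTube L u v) = 0) : fibreInnerAd L w Ω g u = 0 := by
  unfold fibreInnerAd
  have hae : ∀ᵐ v ∂orthoTransverse L, v ∈ capBalancedSet L := by rw [ae_iff]; exact orthoTransverse_compl_capBalancedSet L
  refine integral_eq_zero_of_ae (hae.mono fun v hv => ?_)
  show g (orthoTube L u v) * Ω u (linkEmbed L v) * w (orthoTube L u v) = (0 : (Edge 3 L → Fin 3 → ℝ) → ℝ) v
  rw [hg v hv, zero_mul, zero_mul]; rfl


/-! ## §2 ★★★ The SLOW-WITH-RATE clause from the bricks -/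

/-- ★★★ **SLOW-WITH-RATE CLAUSE FROM THE BRICKS (fixed `β`; adapted fibres; dressed one-site form)**: with (B-N) `|fibreMassAd − γ| ≤ κγ` on `𝒰`, (B-T)-rate upper against
`⟨φW,K_BφW⟩`, the one-site inner statement with factor `e^{ε'λ}` for dressed families, and the arithmetic `(1+κ)e^{ε'λ}μ_k + κμ₀ ≤ (1−κ)e^{ελ/4}μ_k`:
`∃ a ≠ 0, tubeForm β (Σaᵢ P fᵢ) ≤ e^{ελ/4}·σμ_k·‖Σaᵢ P fᵢ‖²_w`. [cite: Luscher1983, §3] [cite: SjostrandZworski2007, §2] -/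
theorem slow_rate_clause_of_bricks {β : ℝ} {w : GaugeConfig 3 L SU2 → ℝ} (hw : Measurable w) {Cw : ℝ} (hCw : ∀ U, |w U| ≤ Cw) (hw0 : ∀ U, 0 ≤ w U)
    (hwinv : ∀ (c : SU2) (U : GaugeConfig 3 L SU2), w (gaugeTransform (fun _ : Site 3 L => c) U) = w U)
    {Ω : GaugeConfig 3 1 SU2 → LinkSpace L → ℝ} (hΩ : Measurable (Function.uncurry Ω)) {CΩ : ℝ} (hCΩ : ∀ u x, |Ω u x| ≤ CΩ)
    (hΩinv : ∀ (g : SU2) (u : GaugeConfig 3 1 SU2) (v : LinkSpace L), Ω (gaugeTransform (fun _ : Site 3 1 => g) u) (adL L g v) = Ω u v)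
    {W : GaugeConfig 3 1 SU2 → ℝ} (hWm : Measurable W) (hW0 : ∀ u, 0 ≤ W u) (hW1 : ∀ u, W u ≤ 1)
    (hWinv : ∀ (g : Site 3 1 → SU2) (u : GaugeConfig 3 1 SU2), W (gaugeTransform g u) = W u)
    {𝒰 : Set (GaugeConfig 3 1 SU2)} (h𝒰 : MeasurableSet 𝒰) (h𝒰inv : ∀ (c : SU2) (u : GaugeConfig 3 1 SU2), gaugeTransform (fun _ : Site 3 1 => c) u ∈ 𝒰 ↔ u ∈ 𝒰)
    {δ₁ : ℝ} (h𝒰δ : ∀ u ∈ 𝒰, orbitDist u < δ₁)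
    {σ γ κ : ℝ} (hσ : 0 ≤ σ) (hγ : 0 < γ) (hκ0 : 0 ≤ κ) (hκ1 : κ < 1)
    (hN : ∀ u ∈ 𝒰, |fibreMassAd L w Ω u - γ| ≤ κ * γ)
    (hT : ∀ φ : GaugeConfig 3 1 SU2 → ℝ, Measurable φ → (∃ C : ℝ, ∀ u, |φ u| ≤ C) → (∀ (g : Site 3 1 → SU2) (u : GaugeConfig 3 1 SU2), φ (gaugeTransform g u) = φ u) →
      (∀ u, φ u ≠ 0 → u ∈ 𝒰) →
      tubeForm β (boFunAd L φ Ω) ≤ σ * γ * (1 + κ) * qform su2Rep ((L : ℝ) ^ 3 * β) (fun u => φ u * W u) (fun u => φ u * W u) +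
        κ * σ * γ * levelValue su2Rep 1 ((L : ℝ) ^ 3 * β) 0 * l2 φ φ)
    {k : ℕ} {ε ε' : ℝ}
    (hOS : ∀ G : Fin (k + 1) → (GaugeConfig 3 1 SU2 → ℝ), (∀ i, Measurable (G i)) → (∀ i, ∃ C : ℝ, ∀ U, |G i U| ≤ C) →
      (∀ i (g : Site 3 1 → SU2) (U : GaugeConfig 3 1 SU2), G i (gaugeTransform g U) = G i U) → (∀ i U, G i U ≠ 0 → orbitDist U < δ₁) →
      (∀ a : Fin (k + 1) → ℝ, a ≠ 0 → 0 < l2 (fun U => ∑ i, a i * G i U) (fun U => ∑ i, a i * G i U)) →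
        ∃ a : Fin (k + 1) → ℝ, a ≠ 0 ∧
          qform su2Rep ((L : ℝ) ^ 3 * β) (fun U => ∑ i, a i * G i U) (fun U => ∑ i, a i * G i U) * levelValue su2Rep 1 ((L : ℝ) ^ 3 * β) 0 ≤
            Real.exp (ε' * bareLambda ((L : ℝ) ^ 3 * β)) * levelValue su2Rep 1 ((L : ℝ) ^ 3 * β) k * levelValue su2Rep 1 ((L : ℝ) ^ 3 * β) 0 *
              l2 (fun U => ∑ i, a i * G i U) (fun U => ∑ i, a i * G i U))
    (hμ0 : 0 < levelValue su2Rep 1 ((L : ℝ) ^ 3 * β) 0) (hμk : 0 ≤ levelValue su2Rep 1 ((L : ℝ) ^ 3 * β) k)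
    (harith : (1 + κ) * Real.exp (ε' * bareLambda ((L : ℝ) ^ 3 * β)) * levelValue su2Rep 1 ((L : ℝ) ^ 3 * β) k + κ * levelValue su2Rep 1 ((L : ℝ) ^ 3 * β) 0 ≤
      (1 - κ) * Real.exp (ε / 4 * bareLambda ((L : ℝ) ^ 3 * β)) * levelValue su2Rep 1 ((L : ℝ) ^ 3 * β) k)
    {f : Fin (k + 1) → GaugeConfig 3 L SU2 → ℝ} (hfm : ∀ i, Measurable (f i)) (hfb : ∀ i, ∃ C : ℝ, ∀ U, |f i U| ≤ C) :
    ∃ a : Fin (k + 1) → ℝ, a ≠ 0 ∧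
      tubeForm β (fun U => ∑ i, a i * boProjAd L w Ω 𝒰 (f i) U) ≤
        Real.exp (ε / 4 * bareLambda ((L : ℝ) ^ 3 * β)) * (σ * levelValue su2Rep 1 ((L : ℝ) ^ 3 * β) k) *
          tubeNormSq w (fun U => ∑ i, a i * boProjAd L w Ω 𝒰 (f i) U) := by
  -- abbreviations
  set B : ℝ := (L : ℝ) ^ 3 * β with hB
  set μ0 : ℝ := levelValue su2Rep 1 B 0 with hμ0def
  set μk : ℝ := levelValue su2Rep 1 B k with hμkdef
  set lam : ℝ := bareLambda B with hlamdef
  have hκ1' : 0 < 1 - κ := by linarith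
  -- fibre-mass lower bound on `𝒰`
  have hZ : ∀ u ∈ 𝒰, γ * (1 - κ) ≤ fibreMassAd L w Ω u := fun u hu => by
    have := (abs_le.mp (hN u hu)).1; linarith
  have hZ₀ : 0 < γ * (1 - κ) := mul_pos hγ hκ1'
  -- the one-site amplitudes `φᵢ = boCoeffAd fᵢ` and their colour averages `Gᵢ`
  set φ : Fin (k + 1) → GaugeConfig 3 1 SU2 → ℝ := fun i => boCoeffAd L w Ω 𝒰 (f i) with hφdef
  have hφm : ∀ i, Measurable (φ i) := fun i => measurable_boCoeffAd hw hΩ h𝒰 (hfm i)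
  choose Cf hCf using hfb
  have hφb : ∀ i, ∀ u, |φ i u| ≤ Cf i * CΩ * Cw * (orthoTransverse L).real Set.univ / (γ * (1 - κ)) := fun i =>
    abs_boCoeffAd_le hCw hCΩ hZ₀ hZ (hCf i)
  have hφs : ∀ i u, φ i u ≠ 0 → u ∈ 𝒰 := fun i u hu => by
    by_contra hnu; exact hu (show boCoeffAd L w Ω 𝒰 (f i) u = 0 by unfold boCoeffAd; rw [Set.indicator_of_notMem hnu])
  set G : Fin (k + 1) → GaugeConfig 3 1 SU2 → ℝ := fun i => colourAvg (L := 1) (φ i) with hGdef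
  have hGm : ∀ i, Measurable (G i) := fun i => measurable_colourAvg (hφm i)
  have hGb : ∀ i, ∃ C : ℝ, ∀ U, |G i U| ≤ C := fun i => ⟨_, abs_colourAvg_le (hφm i) (hφb i)⟩
  have hGg : ∀ i (g : Site 3 1 → SU2) (U : GaugeConfig 3 1 SU2), G i (gaugeTransform g U) = G i U := fun i g U => colourAvg_one_site_gaugeInvariant (φ i) g U
  have hGs𝒰 : ∀ i u, G i u ≠ 0 → u ∈ 𝒰 := fun i u hu => by
    by_contra hnu
    exact hu (colourAvg_eq_zero_of_support (S := 𝒰) (fun c v => h𝒰inv c v) (fun v hv => by by_contra h; exact hv (hφs i v h)) hnu)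
  have hGs : ∀ i U, G i U ≠ 0 → orbitDist U < δ₁ := fun i U hU => h𝒰δ U (hGs𝒰 i U hU)
  -- combinations
  have hcombP : ∀ a : Fin (k + 1) → ℝ, (fun U => ∑ i, a i * boProjAd L w Ω 𝒰 (f i) U) = boFunAd L (fun u => ∑ i, a i * φ i u) Ω := fun a => by
    funext U
    rw [← boProjAd_sum hw hCw hΩ hCΩ 𝒰 a hfm (fun i => ⟨Cf i, hCf i⟩) U]
    unfold boProjAd
    rw [boCoeffAd_sum hw hCw hΩ hCΩ 𝒰 a hfm (fun i => ⟨Cf i, hCf i⟩) |> funext |> congrArg (fun φ' => boFunAd L φ' Ω U)]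
  have hφam : ∀ a : Fin (k + 1) → ℝ, Measurable (fun u => ∑ i, a i * φ i u) := fun a => Finset.measurable_sum _ fun i _ => (hφm i).const_mul _
  have hφab : ∀ a : Fin (k + 1) → ℝ, ∀ u, |∑ i, a i * φ i u| ≤ ∑ i, |a i| * (Cf i * CΩ * Cw * (orthoTransverse L).real Set.univ / (γ * (1 - κ))) := fun a u =>
    (Finset.abs_sum_le_sum_abs _ _).trans (Finset.sum_le_sum fun i _ => by rw [abs_mul]; exact mul_le_mul_of_nonneg_left (hφb i u) (abs_nonneg _))
  have hGa : ∀ a : Fin (k + 1) → ℝ, colourAvg (L := 1) (fun u => ∑ i, a i * φ i u) = fun u => ∑ i, a i * G i u := fun a =>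
    funext fun u => colourAvg_sum a hφm (fun i => ⟨_, hφb i⟩) u
  have hGam : ∀ a : Fin (k + 1) → ℝ, Measurable (fun u => ∑ i, a i * G i u) := fun a => Finset.measurable_sum _ fun i _ => (hGm i).const_mul _
  choose CG hCG using hGb
  have hGab : ∀ a : Fin (k + 1) → ℝ, ∀ u, |∑ i, a i * G i u| ≤ ∑ i, |a i| * CG i := fun a u =>
    (Finset.abs_sum_le_sum_abs _ _).trans (Finset.sum_le_sum fun i _ => by rw [abs_mul]; exact mul_le_mul_of_nonneg_left (hCG i u) (abs_nonneg _))
  have hGag : ∀ (a : Fin (k + 1) → ℝ) (g : Site 3 1 → SU2) (u : GaugeConfig 3 1 SU2), (∑ i, a i * G i (gaugeTransform g u)) = ∑ i, a i * G i u := fun a g u =>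
    Finset.sum_congr rfl fun i _ => by rw [hGg]
  have hGas : ∀ (a : Fin (k + 1) → ℝ) u, (∑ i, a i * G i u) ≠ 0 → u ∈ 𝒰 := fun a u hu => by
    by_contra hnu
    exact hu (Finset.sum_eq_zero fun i _ => by
      have : G i u = 0 := by by_contra h; exact hnu (hGs𝒰 i u h)
      rw [this, mul_zero])
  -- the DRESSED family `G'ᵢ = Gᵢ·W` (bounded measurable, gauge invariant, supported in `{orbitDist < δ₁}`)
  set G' : Fin (k + 1) → GaugeConfig 3 1 SU2 → ℝ := fun i u => G i u * W u with hG'def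
  have hW1' : ∀ u, |W u| ≤ 1 := fun u => by rw [abs_of_nonneg (hW0 u)]; exact hW1 u
  have hG'm : ∀ i, Measurable (G' i) := fun i => (hGm i).mul hWm
  have hG'b : ∀ i, ∃ C : ℝ, ∀ U, |G' i U| ≤ C := fun i => ⟨CG i, fun u => by
    rw [hG'def]; dsimp only; rw [abs_mul]
    have := mul_le_mul (hCG i u) (hW1' u) (abs_nonneg _) ((abs_nonneg _).trans (hCG i u))
    linarith⟩
  have hG'g : ∀ i (g : Site 3 1 → SU2) (U : GaugeConfig 3 1 SU2), G' i (gaugeTransform g U) = G' i U := fun i g U => by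
    rw [hG'def]; dsimp only; rw [hGg, hWinv]
  have hG's : ∀ i U, G' i U ≠ 0 → orbitDist U < δ₁ := fun i U hU => hGs i U (left_ne_zero_of_mul hU)
  have hcombG' : ∀ a : Fin (k + 1) → ℝ, (fun u => ∑ i, a i * G' i u) = fun u => (∑ i, a i * G i u) * W u := fun a => by
    funext u; rw [hG'def, Finset.sum_mul]; exact Finset.sum_congr rfl fun i _ => by ring
  have hG'am : ∀ a : Fin (k + 1) → ℝ, Measurable (fun u => (∑ i, a i * G i u) * W u) := fun a => (hGam a).mul hWm
  have hG'ab : ∀ (a : Fin (k + 1) → ℝ) u, |(∑ i, a i * G i u) * W u| ≤ ∑ i, |a i| * CG i := fun a u => by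
    rw [abs_mul]
    have := mul_le_mul (hGab a u) (hW1' u) (abs_nonneg _) ((abs_nonneg _).trans (hGab a u))
    linarith
  -- `‖G_a W‖² ≤ ‖G_a‖²`
  have hl2W : ∀ a : Fin (k + 1) → ℝ, l2 (fun u => (∑ i, a i * G i u) * W u) (fun u => (∑ i, a i * G i u) * W u) ≤
      l2 (fun u => ∑ i, a i * G i u) (fun u => ∑ i, a i * G i u) := fun a => by
    rw [l2_self_eq_integral_sq, l2_self_eq_integral_sq]
    refine integral_mono ?_ ?_ fun u => ?_
    · exact integrable_of_measurable_abs_le _ ((hG'am a).pow_const 2) (C := (∑ i, |a i| * CG i) ^ 2) fun u => by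
        rw [abs_pow]; exact pow_le_pow_left₀ (abs_nonneg _) (hG'ab a u) 2
    · exact integrable_of_measurable_abs_le _ ((hGam a).pow_const 2) (C := (∑ i, |a i| * CG i) ^ 2) fun u => by
        rw [abs_pow]; exact pow_le_pow_left₀ (abs_nonneg _) (hGab a u) 2
    · dsimp only
      have h1 : W u ^ 2 ≤ 1 := by nlinarith [hW0 u, hW1 u]
      nlinarith [sq_nonneg (∑ i, a i * G i u)]
  -- the key one-site inequality on the dressed family: `qform(G_a W) ≤ e^{ε'λ} μ_k l2(G_a)` for some `a ≠ 0`
  have hkey : ∃ a : Fin (k + 1) → ℝ, a ≠ 0 ∧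
      qform su2Rep B (fun u => (∑ i, a i * G i u) * W u) (fun u => (∑ i, a i * G i u) * W u) ≤
        Real.exp (ε' * lam) * μk * l2 (fun u => ∑ i, a i * G i u) (fun u => ∑ i, a i * G i u) := by
    have hε'0 : 0 ≤ Real.exp (ε' * lam) * μk := mul_nonneg (Real.exp_pos _).le hμk
    by_cases hnd : ∀ a : Fin (k + 1) → ℝ, a ≠ 0 → 0 < l2 (fun U => ∑ i, a i * G' i U) (fun U => ∑ i, a i * G' i U)
    · obtain ⟨a, ha, h⟩ := hOS G' hG'm hG'b hG'g hG's hnd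
      refine ⟨a, ha, ?_⟩
      rw [hcombG' a] at h
      have h' : qform su2Rep B (fun u => (∑ i, a i * G i u) * W u) (fun u => (∑ i, a i * G i u) * W u) * μ0 ≤
          (Real.exp (ε' * lam) * μk * l2 (fun u => (∑ i, a i * G i u) * W u) (fun u => (∑ i, a i * G i u) * W u)) * μ0 := by
        rw [hB, hμ0def, hμkdef, hlamdef]; linarith [h]
      exact (le_of_mul_le_mul_right h' hμ0).trans (mul_le_mul_of_nonneg_left (hl2W a) hε'0)
    · push Not at hnd
      obtain ⟨a, ha, hle⟩ := hnd
      refine ⟨a, ha, ?_⟩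
      rw [hcombG' a] at hle
      have h0 : l2 (fun u => (∑ i, a i * G i u) * W u) (fun u => (∑ i, a i * G i u) * W u) = 0 := le_antisymm hle (l2_self_nonneg_lat _)
      have hsq : ∫ U, ((∑ i, a i * G i U) * W U) ^ 2 ∂configMeasure SU2 1 = 0 := by rw [← l2_self_eq_integral_sq]; exact h0
      rw [qform_eq_zero_of_integral_sq_eq_zero B (hG'am a) (hG'ab a) hsq]
      exact mul_nonneg hε'0 (l2_self_nonneg_lat _)
  obtain ⟨a, ha, hqa⟩ := hkey
  refine ⟨a, ha, ?_⟩
  -- form side: colour average, then the kernel brick (against the DRESSED one-site form)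
  have hPm : Measurable (boFunAd L (fun u => ∑ i, a i * φ i u) Ω) := measurable_boFunAd L (hφam a) hΩ
  have hPb := abs_boFunAd_le L (hφab a) hCΩ
  have hform : tubeForm β (fun U => ∑ i, a i * boProjAd L w Ω 𝒰 (f i) U) ≤
      σ * γ * (1 + κ) * qform su2Rep B (fun u => (∑ i, a i * G i u) * W u) (fun u => (∑ i, a i * G i u) * W u) +
        κ * σ * γ * μ0 * l2 (fun u => ∑ i, a i * G i u) (fun u => ∑ i, a i * G i u) := by
    rw [hcombP a, ← tubeForm_colourAvg β hPm hPb]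
    have hc : colourAvg (boFunAd L (fun u => ∑ i, a i * φ i u) Ω) = boFunAd L (fun u => ∑ i, a i * G i u) Ω := by
      funext U; rw [colourAvg_boFunAd L _ hΩinv U, hGa a]
    rw [hc]
    exact hT _ (hGam a) ⟨_, hGab a⟩ (hGag a) (hGas a)
  -- norm side: colour average does not increase the norm; fibre mass ≥ γ(1−κ)
  have hnorm : γ * (1 - κ) * l2 (fun u => ∑ i, a i * G i u) (fun u => ∑ i, a i * G i u) ≤ tubeNormSq w (fun U => ∑ i, a i * boProjAd L w Ω 𝒰 (f i) U) := by
    rw [hcombP a]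
    have h1 : tubeNormSq w (colourAvg (boFunAd L (fun u => ∑ i, a i * φ i u) Ω)) ≤ tubeNormSq w (boFunAd L (fun u => ∑ i, a i * φ i u) Ω) :=
      tubeNormSq_colourAvg_le hw hCw hw0 hwinv hPm hPb
    have hc : colourAvg (boFunAd L (fun u => ∑ i, a i * φ i u) Ω) = boFunAd L (fun u => ∑ i, a i * G i u) Ω := by
      funext U; rw [colourAvg_boFunAd L _ hΩinv U, hGa a]
    rw [hc, tubeNormSq_boFunAd (hGam a) (hGab a) hΩ hCΩ hw hCw] at h1
    refine le_trans ?_ h1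
    rw [l2_self_eq_integral_sq, ← integral_const_mul]
    have hiL : Integrable (fun u => γ * (1 - κ) * (∑ i, a i * G i u) ^ 2) (configMeasure SU2 1) :=
      (integrable_of_measurable_abs_le _ ((hGam a).pow_const 2) (C := (∑ i, |a i| * CG i) ^ 2) fun u => by
        rw [abs_pow]; exact pow_le_pow_left₀ (abs_nonneg _) (hGab a u) 2).const_mul _
    have hM := measurable_fibreMassAd hw hΩ (L := L)
    have hMb : ∀ u, |fibreMassAd L w Ω u| ≤ CΩ ^ 2 * Cw * (orthoTransverse L).real Set.univ := fun u => by
      haveI := isFiniteMeasure_orthoTransverse L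
      unfold fibreMassAd
      have hCΩ0 : 0 ≤ CΩ := (abs_nonneg _).trans (hCΩ 1 0)
      calc |∫ v, Ω u (linkEmbed L v) ^ 2 * w (orthoTube L u v) ∂orthoTransverse L| ≤ ∫ v, |Ω u (linkEmbed L v) ^ 2 * w (orthoTube L u v)| ∂orthoTransverse L :=
            abs_integral_le_integral_abs
        _ ≤ ∫ _v, CΩ ^ 2 * Cw ∂orthoTransverse L := by
            refine integral_mono_of_nonneg (ae_of_all _ fun v => abs_nonneg _) (integrable_const _) (ae_of_all _ fun v => ?_)
            show |Ω u (linkEmbed L v) ^ 2 * w (orthoTube L u v)| ≤ CΩ ^ 2 * Cw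
            rw [abs_mul, abs_pow]
            exact mul_le_mul (pow_le_pow_left₀ (abs_nonneg _) (hCΩ _ _) 2) (hCw _) (abs_nonneg _) (by positivity)
        _ = CΩ ^ 2 * Cw * (orthoTransverse L).real Set.univ := by rw [integral_const, smul_eq_mul, mul_comm]
    have hiR : Integrable (fun u => (∑ i, a i * G i u) ^ 2 * fibreMassAd L w Ω u) (configMeasure SU2 1) :=
      integrable_of_measurable_abs_le _ (((hGam a).pow_const 2).mul hM) (C := (∑ i, |a i| * CG i) ^ 2 * (CΩ ^ 2 * Cw * (orthoTransverse L).real Set.univ))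
        fun u => by rw [abs_mul, abs_pow]; exact mul_le_mul (pow_le_pow_left₀ (abs_nonneg _) (hGab a u) 2) (hMb u) (abs_nonneg _) (by positivity)
    refine integral_mono hiL hiR fun u => ?_
    dsimp only
    by_cases hu : u ∈ 𝒰
    · have := hZ u hu; nlinarith [sq_nonneg (∑ i, a i * G i u)]
    · have h0 : (∑ i, a i * G i u) = 0 := by by_contra h; exact hu (hGas a u h)
      rw [h0]; simp
  -- arithmetic
  have hl2 : 0 ≤ l2 (fun u => ∑ i, a i * G i u) (fun u => ∑ i, a i * G i u) := l2_self_nonneg_lat _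
  set n := l2 (fun u => ∑ i, a i * G i u) (fun u => ∑ i, a i * G i u) with hndef
  set q := qform su2Rep B (fun u => ∑ i, a i * G i u) (fun u => ∑ i, a i * G i u) with hqdef
  have h1 : tubeForm β (fun U => ∑ i, a i * boProjAd L w Ω 𝒰 (f i) U) ≤ σ * γ * ((1 + κ) * Real.exp (ε' * lam) * μk + κ * μ0) * n := by
    have := mul_le_mul_of_nonneg_left hqa (by positivity : 0 ≤ σ * γ * (1 + κ))
    nlinarith [hform, this]
  have h2 : σ * γ * ((1 + κ) * Real.exp (ε' * lam) * μk + κ * μ0) * n ≤ σ * γ * ((1 - κ) * Real.exp (ε / 4 * lam) * μk) * n :=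
    mul_le_mul_of_nonneg_right (mul_le_mul_of_nonneg_left harith (by positivity)) hl2
  have h3 : σ * γ * ((1 - κ) * Real.exp (ε / 4 * lam) * μk) * n = Real.exp (ε / 4 * lam) * (σ * μk) * (γ * (1 - κ) * n) := by ring
  have h4 : Real.exp (ε / 4 * lam) * (σ * μk) * (γ * (1 - κ) * n) ≤
      Real.exp (ε / 4 * lam) * (σ * μk) * tubeNormSq w (fun U => ∑ i, a i * boProjAd L w Ω 𝒰 (f i) U) :=
    mul_le_mul_of_nonneg_left hnorm (by positivity)
  linarith [h1, h2, h3, h4]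


end Summit.QuantumFields.YangMills.Theorems.FemtoTransferGap.RateTube

end
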